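import Summits.CriticalPhenomena.SAWScalingLimit.Theorems.SAWDevelopingMapObservableToSLETypeLadderCarvedReductionSandwich
import HarnessLib

/-!
# Reversal symmetry of the carved law on sub-family cells (piece (G6-sym) of stub T2b″)

Crux `SAWDevelopingMap.ObservableToSLE` (stmt-CriticalPhenomena-10472), line `six-class-type-ladder`,
stub T2b″ `stub_carvedReduction_squeezeSolid`.  Landing target:
`Summits/CriticalPhenomena/SAWScalingLimit/Theorems/SAWDevelopingMapObservableToSLETypeLadderCarvedReductionSqueezeReverse.lean`
(`--supports stmt-CriticalPhenomena-10472`).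

ORIENTATION in the repaired squeeze.  One lattice translation pins only ONE of the two gates of a
carved domain; the other gate approaches its limit height at speed `o(1)`, and the outer containment
`Reach_k ⊆ N(δ_k) ⊆ E_n` forces that approach to be FROM ABOVE.  When the `b`-gate approaches from
below one pins the `b`-gate instead, applies ARL″ (whose thresholds are common at `pt 0` and free at
`pt 1`) to the super-domain marked the other way round, and obtains the carved-mass bound for the
carved law read BACKWARDS, `carvedLaw Ω δ U q' q`.  This file supplies the lattice identity closing
that case: the carved mass of a sub-family cell — indeed of any event depending on the SET of visited
vertices — is the same for the carved law from `u` to `v` and from `v` to `u` (reversal of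
self-avoiding walks is a weight-preserving bijection; `carvedLaw_reverse_apply_of_forall_mem`,
registered as `stub_carvedReduction_carvedLawReverse`).

Sources: N. Madras, G. Slade, The Self-Avoiding Walk (1993) §1.2 (reversal symmetry);
H. Duminil-Copin, S. Smirnov, Ann. of Math. 175 (2012) §4 (the critical weights `x_c^{ℓ(γ)}`).
-/

noncomputable section

open scoped BigOperators ENNReal Classical
open MeasureTheory
open Literature.Probability.LatticeModels (HexVertex hexGraph hexCenter)
open Literature.Probability.RandomPlanarGeometry
open Literature.Probability.RandomPlanarGeometry.SAW

namespace Summit.CriticalPhenomena.SAWScalingLimit.Theorems.ObservableToSLE.TypeLadder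

open Summit.CriticalPhenomena.SAWScalingLimit.Theorems.ObservableToSLER.BridgeGate

variable {Ω : Set ℂ} {δ : ℝ} {u v : HexVertex}

/-- Reversal of self-avoiding walks of `Ω_δ`, as a bijection from the walks `u → v` onto the walks
`v → u`. -/
theorem exists_reverseEquiv (Ω : Set ℂ) (δ : ℝ) (u v : HexVertex) :
    ∃ E : HexDomainSAW Ω δ u v ≃ HexDomainSAW Ω δ v u, ∀ γ, (E γ).walk = γ.walk.reverse := by
  refine ⟨⟨fun γ => ⟨γ.walk.reverse, γ.isPath.reverse⟩, fun γ => ⟨γ.walk.reverse, γ.isPath.reverse⟩,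
    fun γ => ?_, fun γ => ?_⟩, fun γ => rfl⟩
  · cases γ; simp
  · cases γ; simp

/-- **Reversal symmetry of carved weights on support events.**  For a property `P` of the SET of
visited vertices, the carved weight (walks of `Ω_δ` avoiding `S`, weight `x_c^{ℓ}`) of
`{ξ : u → v | P (support)}` equals that of `{ξ : v → u | P (support)}`. -/
theorem carvedWeight_reverse_apply [Finite (HexDomainSAW Ω δ u v)] (S : Set HexVertex)
    (P : Set HexVertex → Prop) :
    carvedWeight Ω δ S u v {ξ | P {w | w ∈ ξ.walk.support}} =
      carvedWeight Ω δ S v u {ξ | P {w | w ∈ ξ.walk.support}} := by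
  obtain ⟨E, hE⟩ := exists_reverseEquiv Ω δ u v
  haveI : Fintype (HexDomainSAW Ω δ u v) := Fintype.ofFinite _
  haveI : Finite (HexDomainSAW Ω δ v u) := Finite.of_equiv _ E
  haveI : Fintype (HexDomainSAW Ω δ v u) := Fintype.ofFinite _
  have hsupp : ∀ γ : HexDomainSAW Ω δ u v, {w | w ∈ (E γ).walk.support} = {w | w ∈ γ.walk.support} := by
    intro γ
    ext w
    simp [hE, SimpleGraph.Walk.support_reverse]
  have hcount : ∀ γ : HexDomainSAW Ω δ u v, (E γ).vertexCount = γ.vertexCount := by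
    intro γ
    simp [EmbDomainSAW.vertexCount, EmbDomainSAW.length, hE, SimpleGraph.Walk.length_reverse]
  rw [carvedWeight, carvedWeight, Measure.restrict_apply MeasurableSpace.measurableSet_top,
    Measure.restrict_apply MeasurableSpace.measurableSet_top,
    ObservableToSLE.FloorRatio.embWeight_apply_eq_sum, ObservableToSLE.FloorRatio.embWeight_apply_eq_sum]
  refine Finset.sum_equiv E (fun γ => ?_) (fun γ _ => by rw [hcount])
  simp only [Finset.mem_filter, Finset.mem_univ, true_and, Set.mem_inter_iff, Set.mem_setOf_eq]
  rw [hsupp γ]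
  have hmem : ∀ w, w ∈ (E γ).walk.support ↔ w ∈ γ.walk.support := fun w => by
    simp [hE, SimpleGraph.Walk.support_reverse]
  constructor
  · rintro ⟨hP, hS⟩
    exact ⟨hP, fun w hw => hS w ((hmem w).1 hw)⟩
  · rintro ⟨hP, hS⟩
    exact ⟨hP, fun w hw => hS w ((hmem w).2 hw)⟩

/-- **Reversal symmetry of the carved law on support events** (in particular on sub-family cells
`{ξ | ∀ w ∈ support, w ∈ Λ}`): `carvedLaw Ω δ S u v {P(support)} = carvedLaw Ω δ S v u {P(support)}`. -/
theorem carvedLaw_reverse_apply [Finite (HexDomainSAW Ω δ u v)] (S : Set HexVertex)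
    (P : Set HexVertex → Prop) :
    carvedLaw Ω δ S u v {ξ | P {w | w ∈ ξ.walk.support}} =
      carvedLaw Ω δ S v u {ξ | P {w | w ∈ ξ.walk.support}} := by
  have huniv : carvedWeight Ω δ S u v Set.univ = carvedWeight Ω δ S v u Set.univ := by
    have h := carvedWeight_reverse_apply (Ω := Ω) (δ := δ) (u := u) (v := v) S (fun _ => True)
    simpa using h
  rw [carvedLaw, carvedLaw, Measure.smul_apply, Measure.smul_apply, huniv,
    carvedWeight_reverse_apply S P]

/-- The sub-family cell event is a support event: reversal symmetry of its carved mass. -/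
theorem carvedLaw_reverse_apply_of_forall_mem [Finite (HexDomainSAW Ω δ u v)] (S : Set HexVertex)
    (Λ : Finset HexVertex) :
    carvedLaw Ω δ S u v {ξ | ∀ w ∈ ξ.walk.support, w ∈ Λ} =
      carvedLaw Ω δ S v u {ξ | ∀ w ∈ ξ.walk.support, w ∈ Λ} := by
  have h := carvedLaw_reverse_apply (Ω := Ω) (δ := δ) (u := u) (v := v) S
    (fun A : Set HexVertex => A ⊆ (↑Λ : Set HexVertex))
  have e1 : {ξ : HexDomainSAW Ω δ u v | {w | w ∈ ξ.walk.support} ⊆ (↑Λ : Set HexVertex)} =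
      {ξ | ∀ w ∈ ξ.walk.support, w ∈ Λ} := by
    ext ξ; simp [Set.subset_def]
  have e2 : {ξ : HexDomainSAW Ω δ v u | {w | w ∈ ξ.walk.support} ⊆ (↑Λ : Set HexVertex)} =
      {ξ | ∀ w ∈ ξ.walk.support, w ∈ Λ} := by
    ext ξ; simp [Set.subset_def]
  rw [e1, e2] at h
  exact h

/-- **Registered sub-goal `stub_carvedReduction_carvedLawReverse`** (crux item
stmt-CriticalPhenomena-10472, stub T2b″ `stub_carvedReduction_squeezeSolid`, piece (G6-sym)
REVERSAL SYMMETRY OF THE CARVED MASS OF A CELL): for bounded `Ω`, `δ ≠ 0`, the carved mass of a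
sub-family cell is the same from `u` to `v` as from `v` to `u`. -/
theorem stub_carvedReduction_carvedLawReverse :
    ∀ (Ω : Set ℂ) (δ : ℝ) (S : Set HexVertex) (u v : HexVertex) (Λ : Finset HexVertex),
      Finite (HexDomainSAW Ω δ u v) →
      carvedLaw Ω δ S u v {ξ | ∀ w ∈ ξ.walk.support, w ∈ Λ} =
        carvedLaw Ω δ S v u {ξ | ∀ w ∈ ξ.walk.support, w ∈ Λ} := by
  intro Ω δ S u v Λ hfin
  haveI := hfin
  exact carvedLaw_reverse_apply_of_forall_mem S Λ

end Summit.CriticalPhenomena.SAWScalingLimit.Theorems.ObservableToSLE.TypeLadder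

end
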